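import Mathlib
import HarnessLib
import Summits.QuantumFields.YangMills.Theses.LangevinControlUV
import Summits.QuantumFields.YangMills.Theorems.FemtoCurvatureSkewness.Negative.ZeroCoupling
import Summits.QuantumFields.YangMills.Theorems.FemtoCurvatureSkewness.Negative.WeakCoupling
import Summits.QuantumFields.YangMills.Theorems.LangevinControlUVFemtoCurvatureSkewnessHypercubicCovSymmetry
import Summits.QuantumFields.YangMills.Theorems.LangevinControlUVFemtoCurvatureSkewnessPermanentalRigidity
import Summits.QuantumFields.YangMills.Theorems.LangevinControlUVFemtoCurvatureSkewnessPerpPropagatorPos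
import Summits.QuantumFields.YangMills.Theorems.LangevinControlUVFemtoCurvatureSkewnessDominanceFromCoupling
import Summits.QuantumFields.YangMills.Theorems.LangevinControlUVFemtoCurvatureSkewnessTotalCumulance

/-!
# Line `Sketch-ideator3` (card `permanental-rigidity`) — crux `LangevinControlUV.FemtoCurvatureSkewness`
(item stmt-QuantumFields-9365)

Skeleton v1 (line LEAD prover-line-stmt-QuantumFields-9365-0, 2026-08-16), reshaped from the ideator-3 sketch
`Cruxes/FemtoCurvatureSkewness/Sketch-ideator3.lean` (rc 0; `crux_of_core : EngineMapIsFastest → FemtoCurvatureSkewness`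
proved there) and written over the LANDED vocabulary of this crux
(`Theorems/FemtoCurvatureSkewness/Negative/ZeroCoupling.lean`: `plaq`, `wE`, `wCov`, `kappa3`, `TwoPointPackage`,
`SkewnessPackage`; the crux is definitionally `∀ G simple, ∀ r a, TwoPointPackage r a → SkewnessPackage r a`, `crux_iff`).

THE LINE (permanental rigidity).  At weak coupling the plaquette field `P = N − Re tr r(U_p)` is, to leading order, a
SQUARED Gaussian (chi-square / permanental) field `(T_r g²/2)·Σ_a (F₀₁^a)²`; for such fields the odd cumulant is slaved
to the covariances, `|κ₃(Q_x,Q_y,Q_z)| = 2^{3/2} d^{-1/2} (Cov_xy Cov_yz Cov_zx)^{1/2}` (Wick/Isserlis, `PermanentalRigidity`).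
Hence a cutoff-uniform LOWER bound on `n¹²|κ₃|` follows from (i) relative-size control `θ < 1` of the permanental
approximation of the plaquette triple in femto boxes (`PermanentalDominance`, the ENGINE: "9365 costs nothing beyond 9363's
engine output") and (ii) the two-point LOWER bounds the crux carries as hypothesis, with `Γ₃ := (c Γ)^{3/2}` — which
honours the disprover's tightness findings (`Γ₃ → 0` along the grid is forced, `not_uniformSkewness`; `β₁` load-bearing,
`kappa3_zero_coupling`).  The typed `∀ a` shell of the crux is isolated in ONE residual stub, `PackagePinsScale`
("two unit maps carrying the two-point package are comparable"): it is exactly the route's informal claim that the SAME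
`Γ` in both clauses pins `a(β)` to the physical scale, and exactly what Disproof.lean finding 3 (narrow prime-step maps)
doubts.  Every other line on this crux carries the same residual (triage r1-2, cross-cutting note X).

RESHAPE (v1, lead) of ideator-3's single hypothesis `EngineMapIsFastest = ∃ a, Pkg a ∧ Rigidity a ∧ Fastest a`:
* the engine is stated CONDITIONALLY, `PermanentalDominance : (∃ a, Pkg a) → ∃ a, Pkg a ∧ DominanceBounds a` — it does
  NOT contain the sibling crux 9363 (`FemtoCurvatureTwoPoint`) as a conjunct, yet composes, because the crux's own
  hypothesis supplies a package map; it is registered with its two provable inputs as antecedents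
  (`PermanentalDominanceFromInputs := PermanentalRigidity → PerpPropagatorPos → PermanentalDominance`);
* the axis clause `c'·Cov(P₀,P_{ne₂}) ≤ Cov(P₀,P_{ne₃})` of ideator-3's dominance is REMOVED from the engine and proved
  from hypercubic symmetry (`HypercubicCovSymmetry`, provable now from the tree's `wilsonExpectation_comp_configPerm`);
  only the diagonal clause `c'·Cov(P₀,P_{ne₂}) ≤ Cov(P_{ne₂},P_{ne₃})` (genuinely extra w.r.t. the package, triage r1-2)
  stays in the engine;
* the residual is stated ENGINE-FREE: `PackagePinsScale`.

Registered stubs (5 ≤ stubs_max = 7): `PermanentalRigidity` (Wick identity — LANDED p88811), `PerpPropagatorPos`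
(transverse torus propagator > 0 at `ne₂`, `n(e₃−e₂)`, all `L` — LANDED p90356: 2-d Yukawa slicing + minimum
principle), `HypercubicCovSymmetry` (LANDED p87496), `PermanentalDominanceFromInputs` (ENGINE, crux-sized, open),
`PackagePinsScale` (residual, open).  Skeleton v3 (08:30Z): engine reshaped to `CouplingBounds` with two more provable
antecedents `DominanceFromCoupling` (LANDED p91120) and `TotalCumulance` (LANDED p91552).  Skeleton v4 (09:20Z): 2 `sorry`
left — `PermanentalCouplingFromInputs` (ENGINE) and `PackagePinsScale` (residual).

Composition (kernel-checked below; `sorry` only inside the `Stub` namespace):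
`PermanentalDominanceFromInputs` (fed `PermanentalRigidity`, `PerpPropagatorPos`) gives a package map `a₀` with dominance;
`rigidity_of_dominance` (+ `HypercubicCovSymmetry`) turns dominance into `c₃ (n⁸Cov₀₂)^{3/2} ≤ n¹²|κ₃|` on `a₀`-boxes;
`PackagePinsScale` makes every package map `a'` satisfy `ε a₀ ≤ a'` eventually, so `a'`-boxes of size `ε ℓ₁` are
`a₀`-boxes; `skewnessPackage_of_rigidity` closes with `Γ₃ := (c'Γ')^{3/2}` from `a'`'s OWN package
(`FemtoCurvatureSkewness_of`, `FemtoCurvatureSkewness_proof`).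

Disproof.lean (cdisprove v4, read 2026-08-16) honoured: finding 1 (no vacuity; any `¬` needs a 9363 witness) — the
line proves S; findings 2/4b (level sets; `Γ₃(n a β) → 0` forced) — `Γ₃ = (c'Γ')^{3/2}` inherits the package's decay;
finding 4 (`β = 0` exact zero, `β₁` load-bearing) — `β₁ ≥ β₀'` of the package; finding 3 (adversarial step maps) —
isolated verbatim as `PackagePinsScale`; §4 Targets: none yet.
-/

noncomputable section

namespace Summit.QuantumFields.YangMills.Cruxes.FemtoCurvatureSkewness.SketchIdeator3

open MeasureTheory ProbabilityTheory Filter Topology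
open scoped BigOperators
open Literature.MathematicalPhysics.QuantumFieldTheory
open Summit.QuantumFields.YangMills.Theses.LangevinControlUV (FemtoCurvatureSkewness)
open Summit.QuantumFields.YangMills.Theorems.FemtoCurvatureSkewness.Negative
  (plaq wE wCov kappa3 TwoPointPackage SkewnessPackage)

/-! ## Vocabulary of the line -/

/-- **Stub L1 `PermanentalRigidity` (Wick/Isserlis at degree 6; provable now).** For a centred Gaussian triple
`φ_a = ∑ i, M a i ξ_i` (`ξ` iid standard normal) with Gram matrix `g = M Mᵀ`:
`Cov(φ₀², φ₁²) = 2 g₀₁²` and `κ₃(φ₀², φ₁², φ₂²) = 8 g₀₁ g₁₂ g₂₀` — the modulus of the odd cumulant of a permanental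
triple is a function of its covariances.  (Ideator-3's statement with the `let`s inlined and the cumulants written in
raw-moment form `κ₃ = E[XYZ] − E X·E[YZ] − E Y·E[XZ] − E Z·E[XY] + 2·E X E Y E Z`, so that the registered signature is
self-contained over Mathlib.) -/
def PermanentalRigidity : Prop :=
  ∀ (m : ℕ) (M : Matrix (Fin 3) (Fin m) ℝ),
    (∫ ξ, (∑ i, M 0 i * ξ i) ^ 2 * (∑ i, M 1 i * ξ i) ^ 2 ∂Measure.pi fun _ : Fin m => gaussianReal 0 1) -
          (∫ ξ, (∑ i, M 0 i * ξ i) ^ 2 ∂Measure.pi fun _ : Fin m => gaussianReal 0 1) *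
            (∫ ξ, (∑ i, M 1 i * ξ i) ^ 2 ∂Measure.pi fun _ : Fin m => gaussianReal 0 1) =
        2 * ((M * M.transpose) 0 1) ^ 2 ∧
      (∫ ξ, (∑ i, M 0 i * ξ i) ^ 2 * (∑ i, M 1 i * ξ i) ^ 2 * (∑ i, M 2 i * ξ i) ^ 2 ∂Measure.pi fun _ : Fin m => gaussianReal 0 1) -
            (∫ ξ, (∑ i, M 0 i * ξ i) ^ 2 ∂Measure.pi fun _ : Fin m => gaussianReal 0 1) *
              (∫ ξ, (∑ i, M 1 i * ξ i) ^ 2 * (∑ i, M 2 i * ξ i) ^ 2 ∂Measure.pi fun _ : Fin m => gaussianReal 0 1) -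
            (∫ ξ, (∑ i, M 1 i * ξ i) ^ 2 ∂Measure.pi fun _ : Fin m => gaussianReal 0 1) *
              (∫ ξ, (∑ i, M 0 i * ξ i) ^ 2 * (∑ i, M 2 i * ξ i) ^ 2 ∂Measure.pi fun _ : Fin m => gaussianReal 0 1) -
            (∫ ξ, (∑ i, M 2 i * ξ i) ^ 2 ∂Measure.pi fun _ : Fin m => gaussianReal 0 1) *
              (∫ ξ, (∑ i, M 0 i * ξ i) ^ 2 * (∑ i, M 1 i * ξ i) ^ 2 ∂Measure.pi fun _ : Fin m => gaussianReal 0 1) +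
          2 * ((∫ ξ, (∑ i, M 0 i * ξ i) ^ 2 ∂Measure.pi fun _ : Fin m => gaussianReal 0 1) *
            (∫ ξ, (∑ i, M 1 i * ξ i) ^ 2 ∂Measure.pi fun _ : Fin m => gaussianReal 0 1) *
            (∫ ξ, (∑ i, M 2 i * ξ i) ^ 2 ∂Measure.pi fun _ : Fin m => gaussianReal 0 1)) =
        8 * (M * M.transpose) 0 1 * (M * M.transpose) 1 2 * (M * M.transpose) 2 0

/-- **Stub L2 `PerpPropagatorPos` (tree-level sign carrier; provable now).** The zero-mode-free lattice
propagator of the `(0,1)`-plaquette field on the `L⁴` torus, `C_L(x) = L⁻⁴ ∑_{k ≠ 0} (k̂₀²+k̂₁²)/k̂² cos(k·x)`, is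
positive at the crux's displacements `n e₂` and `n(e₃ − e₂)` for `1 ≤ n ≤ L/8`.  Proof route: slice in `(k₀,k₁)`:
the `(k₂,k₃)`-sum is `m² · L² · (m² − Δ_{T²_L})⁻¹(0, x)` with `m² = k̂₀² + k̂₁² > 0`, a resolvent of the 2-d torus
Laplacian, entrywise `> 0` by the minimum principle.  (Ideator-3's statement with the `let`s `kh`, `w` inlined so that
the registered signature is self-contained; kit j009212.) -/
def PerpPropagatorPos : Prop :=
  ∀ (L n : ℕ) [NeZero L], 1 ≤ n → 8 * n ≤ L →
    0 < ∑ k : Fin 4 → ZMod L,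
        (if k = 0 then 0 else ((2 - 2 * Real.cos (2 * Real.pi * ((k 0).val : ℝ) / L)) + (2 - 2 * Real.cos (2 * Real.pi * ((k 1).val : ℝ) / L))) /
          ((2 - 2 * Real.cos (2 * Real.pi * ((k 0).val : ℝ) / L)) + (2 - 2 * Real.cos (2 * Real.pi * ((k 1).val : ℝ) / L)) +
            (2 - 2 * Real.cos (2 * Real.pi * ((k 2).val : ℝ) / L)) + (2 - 2 * Real.cos (2 * Real.pi * ((k 3).val : ℝ) / L)))) *
          Real.cos (2 * Real.pi * ((k 2).val : ℝ) * n / L) ∧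
    0 < ∑ k : Fin 4 → ZMod L,
        (if k = 0 then 0 else ((2 - 2 * Real.cos (2 * Real.pi * ((k 0).val : ℝ) / L)) + (2 - 2 * Real.cos (2 * Real.pi * ((k 1).val : ℝ) / L))) /
          ((2 - 2 * Real.cos (2 * Real.pi * ((k 0).val : ℝ) / L)) + (2 - 2 * Real.cos (2 * Real.pi * ((k 1).val : ℝ) / L)) +
            (2 - 2 * Real.cos (2 * Real.pi * ((k 2).val : ℝ) / L)) + (2 - 2 * Real.cos (2 * Real.pi * ((k 3).val : ℝ) / L)))) *
          Real.cos (2 * Real.pi * (((k 3).val : ℝ) - ((k 2).val : ℝ)) * n / L)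

/-- **Stub L3 `HypercubicCovSymmetry` (provable now).** The torus Wilson state is invariant under the coordinate
permutation `2 ↔ 3` (tree `wilsonExpectation_comp_configPerm`, `plaquetteHolonomy_configPerm`), which fixes the
`(0,1)`-plane and maps `n e₃ ↦ n e₂`: `Cov(P_0^{01}, P_{ne₃}^{01}) = Cov(P_0^{01}, P_{ne₂}^{01})`. -/
def HypercubicCovSymmetry : Prop :=
  ∀ (G : Type) [Group G] [TopologicalSpace G] [IsTopologicalGroup G] [CompactSpace G]
    [MeasurableSpace G] [BorelSpace G] (r : LatticeRep G) (L : ℕ) [NeZero L] (β : ℝ) (n : ℕ),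
    wCov r L β (plaq r L 0 0 1) (plaq r L (Pi.single (3 : Fin 4) ((n : ℕ) : ZMod L)) 0 1) =
      wCov r L β (plaq r L 0 0 1) (plaq r L (Pi.single (2 : Fin 4) ((n : ℕ) : ZMod L)) 0 1)

section Physics

variable {G : Type} [Group G] [TopologicalSpace G] [IsTopologicalGroup G] [CompactSpace G]
  [MeasurableSpace G] [BorelSpace G]

/-- **Permanental dominance bounds for the unit map `a`** (C⁺ of the card, minus the axis clause now supplied by
`HypercubicCovSymmetry`): in `a`'s femto regime (`β ≥ β₁`, `L·a(β) ≤ ℓ₁`), for `1 ≤ n ≤ L/8`, the normalised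
cumulant `n¹²|κ₃|` is within relative error `θ < 1` of the permanental prediction
`√8/√d · (n⁸Cov₀₂ · n⁸Cov₀₃ · n⁸Cov₂₃)^{1/2}` (`d = dim G`), and the diagonal covariance dominates a multiple of the
axis one, `c'·n⁸Cov₀₂ ≤ n⁸Cov₂₃` (`Cov₀₂ = Cov(P_0,P_{ne₂})`, `Cov₀₃ = Cov(P_0,P_{ne₃})`, `Cov₂₃ = Cov(P_{ne₂},P_{ne₃})`). -/
def DominanceBounds (r : LatticeRep G) (a : ℝ → ℝ) : Prop :=
  ∃ (β₁ ℓ₁ d θ c' : ℝ), 0 < ℓ₁ ∧ 0 < d ∧ 0 ≤ θ ∧ θ < 1 ∧ 0 < c' ∧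
    ∀ (L : ℕ) [NeZero L] (β : ℝ), β₁ ≤ β → (L : ℝ) * a β ≤ ℓ₁ →
      ∀ n : ℕ, 1 ≤ n → 8 * n ≤ L →
        |(n : ℝ) ^ 12 * |kappa3 r L β n| -
            Real.sqrt 8 / Real.sqrt d * Real.sqrt
              (((n : ℝ) ^ 8 *
                  wCov r L β (plaq r L 0 0 1) (plaq r L (Pi.single (2 : Fin 4) ((n : ℕ) : ZMod L)) 0 1)) *
                ((n : ℝ) ^ 8 *
                  wCov r L β (plaq r L 0 0 1) (plaq r L (Pi.single (3 : Fin 4) ((n : ℕ) : ZMod L)) 0 1)) *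
                ((n : ℝ) ^ 8 *
                  wCov r L β (plaq r L (Pi.single (2 : Fin 4) ((n : ℕ) : ZMod L)) 0 1)
                    (plaq r L (Pi.single (3 : Fin 4) ((n : ℕ) : ZMod L)) 0 1)))| ≤
          θ * (Real.sqrt 8 / Real.sqrt d * Real.sqrt
              (((n : ℝ) ^ 8 *
                  wCov r L β (plaq r L 0 0 1) (plaq r L (Pi.single (2 : Fin 4) ((n : ℕ) : ZMod L)) 0 1)) *
                ((n : ℝ) ^ 8 *
                  wCov r L β (plaq r L 0 0 1) (plaq r L (Pi.single (3 : Fin 4) ((n : ℕ) : ZMod L)) 0 1)) *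
                ((n : ℝ) ^ 8 *
                  wCov r L β (plaq r L (Pi.single (2 : Fin 4) ((n : ℕ) : ZMod L)) 0 1)
                    (plaq r L (Pi.single (3 : Fin 4) ((n : ℕ) : ZMod L)) 0 1)))) ∧
        c' * ((n : ℝ) ^ 8 *
            wCov r L β (plaq r L 0 0 1) (plaq r L (Pi.single (2 : Fin 4) ((n : ℕ) : ZMod L)) 0 1)) ≤
          (n : ℝ) ^ 8 *
            wCov r L β (plaq r L (Pi.single (2 : Fin 4) ((n : ℕ) : ZMod L)) 0 1)
              (plaq r L (Pi.single (3 : Fin 4) ((n : ℕ) : ZMod L)) 0 1)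

/-- **Rigidity lower bound for the unit map `a`** (C⁰ of the card): in `a`'s femto regime,
`c₃ · (n⁸Cov₀₂) · √(n⁸Cov₀₂) ≤ n¹²|κ₃|` — skewness dominated below by covariance^{3/2}. -/
def RigidityBound (r : LatticeRep G) (a : ℝ → ℝ) : Prop :=
  ∃ (β₁ ℓ₁ c₃ : ℝ), 0 < ℓ₁ ∧ 0 < c₃ ∧
    ∀ (L : ℕ) [NeZero L] (β : ℝ), β₁ ≤ β → (L : ℝ) * a β ≤ ℓ₁ →
      ∀ n : ℕ, 1 ≤ n → 8 * n ≤ L →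
        c₃ * ((n : ℝ) ^ 8 *
            wCov r L β (plaq r L 0 0 1) (plaq r L (Pi.single (2 : Fin 4) ((n : ℕ) : ZMod L)) 0 1)) *
          Real.sqrt ((n : ℝ) ^ 8 *
            wCov r L β (plaq r L 0 0 1) (plaq r L (Pi.single (2 : Fin 4) ((n : ℕ) : ZMod L)) 0 1)) ≤
        (n : ℝ) ^ 12 * |kappa3 r L β n|

/-- **Coupling bounds for the unit map `a`** (the engine's NATURAL output): in `a`'s femto regime, at every admissible
`(L, β, n)`, the normalised cumulant and the three normalised covariances of the plaquette triple are within relative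
error `1/8` of numbers `kQ, b₀₂, b₀₃, b₂₃` obeying the permanental identity `kQ² = (8/d)·b₀₂ b₀₃ b₂₃` (the chaos-2 /
squared-Gaussian projection, `d = dim G`, `PermanentalRigidity` with `d` colour copies), with the diagonal comparability
`c'·b₀₂ ≤ b₂₃`.  `DominanceBounds` follows by the real-number lemma `DominanceFromCoupling`. -/
def CouplingBounds (r : LatticeRep G) (a : ℝ → ℝ) : Prop :=
  ∃ (β₁ ℓ₁ d c' : ℝ), 0 < ℓ₁ ∧ 0 < d ∧ 0 < c' ∧
    ∀ (L : ℕ) [NeZero L] (β : ℝ), β₁ ≤ β → (L : ℝ) * a β ≤ ℓ₁ →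
      ∀ n : ℕ, 1 ≤ n → 8 * n ≤ L →
        ∃ (kQ b₀₂ b₀₃ b₂₃ : ℝ), 0 < b₀₂ ∧ 0 < b₀₃ ∧ 0 < b₂₃ ∧
          kQ ^ 2 = 8 / d * (b₀₂ * b₀₃ * b₂₃) ∧
          |(n : ℝ) ^ 12 * kappa3 r L β n - kQ| ≤ |kQ| / 8 ∧
          |((n : ℝ) ^ 8 *
            wCov r L β (plaq r L 0 0 1) (plaq r L (Pi.single (2 : Fin 4) ((n : ℕ) : ZMod L)) 0 1)) - b₀₂| ≤ b₀₂ / 8 ∧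
          |((n : ℝ) ^ 8 *
            wCov r L β (plaq r L 0 0 1) (plaq r L (Pi.single (3 : Fin 4) ((n : ℕ) : ZMod L)) 0 1)) - b₀₃| ≤ b₀₃ / 8 ∧
          |((n : ℝ) ^ 8 *
            wCov r L β (plaq r L (Pi.single (2 : Fin 4) ((n : ℕ) : ZMod L)) 0 1)
              (plaq r L (Pi.single (3 : Fin 4) ((n : ℕ) : ZMod L)) 0 1)) - b₂₃| ≤ b₂₃ / 8 ∧
          c' * b₀₂ ≤ b₂₃

end Physics

/-- **Stub L4 `DominanceFromCoupling` (elementary real analysis; provable now).** Relative error `1/8` on a signed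
quantity `kP ≈ kQ` and on three positive quantities `aᵢ ≈ bᵢ`, with `kQ² = (8/d)·b₁b₂b₃`, gives
`| |kP| − √8/√d·√(a₁a₂a₃) | ≤ ½ · √8/√d·√(a₁a₂a₃)` (constants: `(9/8)(8/7)^{3/2} − 1 ≈ 0.375 ≤ ½` and
`1 − (7/8)(8/9)^{3/2} ≈ 0.267 ≤ ½`). -/
def DominanceFromCoupling : Prop :=
  ∀ (d kP kQ a₁ a₂ a₃ b₁ b₂ b₃ : ℝ), 0 < d → 0 < b₁ → 0 < b₂ → 0 < b₃ →
    kQ ^ 2 = 8 / d * (b₁ * b₂ * b₃) →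
    |kP - kQ| ≤ |kQ| / 8 → |a₁ - b₁| ≤ b₁ / 8 → |a₂ - b₂| ≤ b₂ / 8 → |a₃ - b₃| ≤ b₃ / 8 →
    |(|kP|) - Real.sqrt 8 / Real.sqrt d * Real.sqrt (a₁ * a₂ * a₃)| ≤
      1 / 2 * (Real.sqrt 8 / Real.sqrt d * Real.sqrt (a₁ * a₂ * a₃))

/-- **Stub L5 `TotalCumulance` (Brillinger 1969, law of total cumulance at order 3; provable now — proved in the g2-i1
sketch `SketchG2I1.total_cumulance3`, to be ported).**  For bounded measurable `X, Y, Z`, a probability measure `μ`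
and a sub-σ-algebra `m ≤ mΩ` (binder convention: `m` bound before the ambient `mΩ`):
`κ₃(X,Y,Z) = E κ₃(X,Y,Z | m) + Σ_{3} E[(E[X|m] − EX)·Cov(Y,Z|m)] + κ₃(E[X|m], E[Y|m], E[Z|m])` — the decomposition
over the constant-mode / exterior datum used by the engine's toron conditioning (ideator-3's second card
`background-shifted-positivity`). -/
def TotalCumulance : Prop :=
  ∀ (Ω : Type) (m mΩ : MeasurableSpace Ω) (μ : Measure Ω) [IsProbabilityMeasure μ], m ≤ mΩ →
    ∀ (X Y Z : Ω → ℝ), Measurable X → Measurable Y → Measurable Z →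
      (∃ M : ℝ, ∀ ω, |X ω| ≤ M ∧ |Y ω| ≤ M ∧ |Z ω| ≤ M) →
      ∫ ω, (X ω - ∫ a, X a ∂μ) * (Y ω - ∫ a, Y a ∂μ) * (Z ω - ∫ a, Z a ∂μ) ∂μ =
        (∫ ω, ((μ[fun a => X a * Y a * Z a|m]) ω
            - (μ[X|m]) ω * ((μ[fun a => Y a * Z a|m]) ω - (μ[Y|m]) ω * (μ[Z|m]) ω)
            - (μ[Y|m]) ω * ((μ[fun a => X a * Z a|m]) ω - (μ[X|m]) ω * (μ[Z|m]) ω)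
            - (μ[Z|m]) ω * ((μ[fun a => X a * Y a|m]) ω - (μ[X|m]) ω * (μ[Y|m]) ω)
            - (μ[X|m]) ω * (μ[Y|m]) ω * (μ[Z|m]) ω) ∂μ)
        + (∫ ω, ((μ[X|m]) ω - ∫ a, X a ∂μ) * ((μ[fun a => Y a * Z a|m]) ω - (μ[Y|m]) ω * (μ[Z|m]) ω) ∂μ)
        + (∫ ω, ((μ[Y|m]) ω - ∫ a, Y a ∂μ) * ((μ[fun a => X a * Z a|m]) ω - (μ[X|m]) ω * (μ[Z|m]) ω) ∂μ)
        + (∫ ω, ((μ[Z|m]) ω - ∫ a, Z a ∂μ) * ((μ[fun a => X a * Y a|m]) ω - (μ[X|m]) ω * (μ[Y|m]) ω) ∂μ)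
        + ∫ ω, ((μ[X|m]) ω - ∫ a, X a ∂μ) * ((μ[Y|m]) ω - ∫ a, Y a ∂μ) * ((μ[Z|m]) ω - ∫ a, Z a ∂μ) ∂μ

/-- **Engine statement `PermanentalCoupling` (crux-sized), conditional form.**  For compact simple `G` and any `r`:
IF some unit map carries the two-point package, THEN some unit map carries the package together with the coupling
bounds (`CouplingBounds`) in its femto regime.  (It does not assert the sibling crux 9363; for the intended package map —
the physical lattice spacing — it is ultraviolet stability WITH observables: a Gaussian-square approximation of the
plaquette triple at relative accuracy `O(g²(ℓ)) ≤ 1/8` on cumulants and covariances, Bałaban/MRS-grade or the route's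
Boué–Dupuis engine.) -/
def PermanentalCoupling : Prop :=
  ∀ (G : Type) [Group G] [TopologicalSpace G] [IsTopologicalGroup G] [CompactSpace G],
    IsCompactSimpleLieGroup G →
      letI : MeasurableSpace G := borel G
      haveI : BorelSpace G := ⟨rfl⟩
      ∀ (r : LatticeRep G), (∃ a : ℝ → ℝ, TwoPointPackage r a) →
        ∃ a : ℝ → ℝ, TwoPointPackage r a ∧ CouplingBounds r a

/-- **Stub E `PermanentalCouplingFromInputs` — registered form of the ENGINE**: `PermanentalCoupling` from its three
provable inputs (`PermanentalRigidity`: the Wick identity behind `kQ² = (8/d)·b₀₂b₀₃b₂₃`; `PerpPropagatorPos`: the sign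
and non-degeneracy of the tree-level covariances the relative error is measured against; `TotalCumulance`: the
decomposition over the constant-mode datum used to control torons in the femto box). -/
def PermanentalCouplingFromInputs : Prop :=
  PermanentalRigidity → PerpPropagatorPos → TotalCumulance → PermanentalCoupling

/-- **Stub R `PackagePinsScale` — the `∀ a` residual of the TYPED crux, engine-free.**  Two unit maps that both carry
the two-point package of `FemtoCurvatureTwoPoint` (same `G`, `r`) are comparable: `ε·a ≤ a'` for all large `β`.
This is the route's own slogan "the SAME `Γ` in both clauses pins `a(β)` to the physical scale" made a statement;
Disproof.lean finding 3 (narrow prime-step unit maps pass the package on fixed-torus asymptotics alone) is the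
standing objection — if such maps exist for some `(G, r)` admitting any package map, this stub is false and the typed
crux reduces to global non-vanishing of `κ₃` (open IR sign, finding 3 / BarrierNotes B2). -/
def PackagePinsScale : Prop :=
  ∀ (G : Type) [Group G] [TopologicalSpace G] [IsTopologicalGroup G] [CompactSpace G],
    IsCompactSimpleLieGroup G →
      letI : MeasurableSpace G := borel G
      haveI : BorelSpace G := ⟨rfl⟩
      ∀ (r : LatticeRep G) (a a' : ℝ → ℝ), TwoPointPackage r a → TwoPointPackage r a' →
        ∃ ε β₂ : ℝ, 0 < ε ∧ ∀ β : ℝ, β₂ ≤ β → ε * a β ≤ a' β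

/-! ## Landed inputs (former stubs L1–L5, now tree theorems) -/

/-- Former stub L1 `PermanentalRigidity` — LANDED (p88811, `Theorems/LangevinControlUVFemtoCurvatureSkewnessPermanentalRigidity.lean`). -/
theorem permanentalRigidity_holds :
  ∀ (m : ℕ) (M : Matrix (Fin 3) (Fin m) ℝ),
    (∫ ξ, (∑ i, M 0 i * ξ i) ^ 2 * (∑ i, M 1 i * ξ i) ^ 2 ∂Measure.pi fun _ : Fin m => gaussianReal 0 1) -
          (∫ ξ, (∑ i, M 0 i * ξ i) ^ 2 ∂Measure.pi fun _ : Fin m => gaussianReal 0 1) *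
            (∫ ξ, (∑ i, M 1 i * ξ i) ^ 2 ∂Measure.pi fun _ : Fin m => gaussianReal 0 1) =
        2 * ((M * M.transpose) 0 1) ^ 2 ∧
      (∫ ξ, (∑ i, M 0 i * ξ i) ^ 2 * (∑ i, M 1 i * ξ i) ^ 2 * (∑ i, M 2 i * ξ i) ^ 2 ∂Measure.pi fun _ : Fin m => gaussianReal 0 1) -
            (∫ ξ, (∑ i, M 0 i * ξ i) ^ 2 ∂Measure.pi fun _ : Fin m => gaussianReal 0 1) *
              (∫ ξ, (∑ i, M 1 i * ξ i) ^ 2 * (∑ i, M 2 i * ξ i) ^ 2 ∂Measure.pi fun _ : Fin m => gaussianReal 0 1) -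
            (∫ ξ, (∑ i, M 1 i * ξ i) ^ 2 ∂Measure.pi fun _ : Fin m => gaussianReal 0 1) *
              (∫ ξ, (∑ i, M 0 i * ξ i) ^ 2 * (∑ i, M 2 i * ξ i) ^ 2 ∂Measure.pi fun _ : Fin m => gaussianReal 0 1) -
            (∫ ξ, (∑ i, M 2 i * ξ i) ^ 2 ∂Measure.pi fun _ : Fin m => gaussianReal 0 1) *
              (∫ ξ, (∑ i, M 0 i * ξ i) ^ 2 * (∑ i, M 1 i * ξ i) ^ 2 ∂Measure.pi fun _ : Fin m => gaussianReal 0 1) +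
          2 * ((∫ ξ, (∑ i, M 0 i * ξ i) ^ 2 ∂Measure.pi fun _ : Fin m => gaussianReal 0 1) *
            (∫ ξ, (∑ i, M 1 i * ξ i) ^ 2 ∂Measure.pi fun _ : Fin m => gaussianReal 0 1) *
            (∫ ξ, (∑ i, M 2 i * ξ i) ^ 2 ∂Measure.pi fun _ : Fin m => gaussianReal 0 1)) =
        8 * (M * M.transpose) 0 1 * (M * M.transpose) 1 2 * (M * M.transpose) 2 0 :=
  Summit.QuantumFields.YangMills.Theorems.FemtoCurvatureSkewness.PermanentalRigidity

/-- Former stub L2 `PerpPropagatorPos` — LANDED (p90356, `Theorems/LangevinControlUVFemtoCurvatureSkewnessPerpPropagatorPos.lean`). -/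
theorem perpPropagatorPos_holds :
  ∀ (L n : ℕ) [NeZero L], 1 ≤ n → 8 * n ≤ L →
    0 < ∑ k : Fin 4 → ZMod L,
        (if k = 0 then 0 else ((2 - 2 * Real.cos (2 * Real.pi * ((k 0).val : ℝ) / L)) + (2 - 2 * Real.cos (2 * Real.pi * ((k 1).val : ℝ) / L))) /
          ((2 - 2 * Real.cos (2 * Real.pi * ((k 0).val : ℝ) / L)) + (2 - 2 * Real.cos (2 * Real.pi * ((k 1).val : ℝ) / L)) +
            (2 - 2 * Real.cos (2 * Real.pi * ((k 2).val : ℝ) / L)) + (2 - 2 * Real.cos (2 * Real.pi * ((k 3).val : ℝ) / L)))) *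
          Real.cos (2 * Real.pi * ((k 2).val : ℝ) * n / L) ∧
    0 < ∑ k : Fin 4 → ZMod L,
        (if k = 0 then 0 else ((2 - 2 * Real.cos (2 * Real.pi * ((k 0).val : ℝ) / L)) + (2 - 2 * Real.cos (2 * Real.pi * ((k 1).val : ℝ) / L))) /
          ((2 - 2 * Real.cos (2 * Real.pi * ((k 0).val : ℝ) / L)) + (2 - 2 * Real.cos (2 * Real.pi * ((k 1).val : ℝ) / L)) +
            (2 - 2 * Real.cos (2 * Real.pi * ((k 2).val : ℝ) / L)) + (2 - 2 * Real.cos (2 * Real.pi * ((k 3).val : ℝ) / L)))) *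
          Real.cos (2 * Real.pi * (((k 3).val : ℝ) - ((k 2).val : ℝ)) * n / L) :=
  Summit.QuantumFields.YangMills.Theorems.FemtoCurvatureSkewness.PerpPropagatorPos

/-- Former stub L3 `HypercubicCovSymmetry` — LANDED (p87496, `Theorems/LangevinControlUVFemtoCurvatureSkewnessHypercubicCovSymmetry.lean`). -/
theorem hypercubicCovSymmetry_holds :
  ∀ (G : Type) [Group G] [TopologicalSpace G] [IsTopologicalGroup G] [CompactSpace G]
    [MeasurableSpace G] [BorelSpace G] (r : LatticeRep G) (L : ℕ) [NeZero L] (β : ℝ) (n : ℕ),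
    wCov r L β (plaq r L 0 0 1) (plaq r L (Pi.single (3 : Fin 4) ((n : ℕ) : ZMod L)) 0 1) =
      wCov r L β (plaq r L 0 0 1) (plaq r L (Pi.single (2 : Fin 4) ((n : ℕ) : ZMod L)) 0 1) :=
  Summit.QuantumFields.YangMills.Theorems.FemtoCurvatureSkewness.HypercubicCovSymmetry

/-- Former stub L4 `DominanceFromCoupling` — LANDED (p91120, `Theorems/LangevinControlUVFemtoCurvatureSkewnessDominanceFromCoupling.lean`). -/
theorem dominanceFromCoupling_holds :
  ∀ (d kP kQ a₁ a₂ a₃ b₁ b₂ b₃ : ℝ), 0 < d → 0 < b₁ → 0 < b₂ → 0 < b₃ →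
    kQ ^ 2 = 8 / d * (b₁ * b₂ * b₃) →
    |kP - kQ| ≤ |kQ| / 8 → |a₁ - b₁| ≤ b₁ / 8 → |a₂ - b₂| ≤ b₂ / 8 → |a₃ - b₃| ≤ b₃ / 8 →
    |(|kP|) - Real.sqrt 8 / Real.sqrt d * Real.sqrt (a₁ * a₂ * a₃)| ≤
      1 / 2 * (Real.sqrt 8 / Real.sqrt d * Real.sqrt (a₁ * a₂ * a₃)) :=
  Summit.QuantumFields.YangMills.Theorems.FemtoCurvatureSkewness.DominanceFromCoupling

/-- Former stub L5 `TotalCumulance` — LANDED (p91552, `Theorems/LangevinControlUVFemtoCurvatureSkewnessTotalCumulance.lean`). -/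
theorem totalCumulance_holds :
  ∀ (Ω : Type) (m mΩ : MeasurableSpace Ω) (μ : Measure Ω) [IsProbabilityMeasure μ], m ≤ mΩ →
    ∀ (X Y Z : Ω → ℝ), Measurable X → Measurable Y → Measurable Z →
      (∃ M : ℝ, ∀ ω, |X ω| ≤ M ∧ |Y ω| ≤ M ∧ |Z ω| ≤ M) →
      ∫ ω, (X ω - ∫ a, X a ∂μ) * (Y ω - ∫ a, Y a ∂μ) * (Z ω - ∫ a, Z a ∂μ) ∂μ =
        (∫ ω, ((μ[fun a => X a * Y a * Z a|m]) ω
            - (μ[X|m]) ω * ((μ[fun a => Y a * Z a|m]) ω - (μ[Y|m]) ω * (μ[Z|m]) ω)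
            - (μ[Y|m]) ω * ((μ[fun a => X a * Z a|m]) ω - (μ[X|m]) ω * (μ[Z|m]) ω)
            - (μ[Z|m]) ω * ((μ[fun a => X a * Y a|m]) ω - (μ[X|m]) ω * (μ[Y|m]) ω)
            - (μ[X|m]) ω * (μ[Y|m]) ω * (μ[Z|m]) ω) ∂μ)
        + (∫ ω, ((μ[X|m]) ω - ∫ a, X a ∂μ) * ((μ[fun a => Y a * Z a|m]) ω - (μ[Y|m]) ω * (μ[Z|m]) ω) ∂μ)
        + (∫ ω, ((μ[Y|m]) ω - ∫ a, Y a ∂μ) * ((μ[fun a => X a * Z a|m]) ω - (μ[X|m]) ω * (μ[Z|m]) ω) ∂μ)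
        + (∫ ω, ((μ[Z|m]) ω - ∫ a, Z a ∂μ) * ((μ[fun a => X a * Y a|m]) ω - (μ[X|m]) ω * (μ[Y|m]) ω) ∂μ)
        + ∫ ω, ((μ[X|m]) ω - ∫ a, X a ∂μ) * ((μ[Y|m]) ω - ∫ a, Y a ∂μ) * ((μ[Z|m]) ω - ∫ a, Z a ∂μ) ∂μ :=
  Summit.QuantumFields.YangMills.Theorems.FemtoCurvatureSkewness.TotalCumulance

/-! ## Registered stubs `Stub.<Name>` (`sorry` lives only here) -/

namespace Stub

/-- Stub E (ENGINE), registered form (statement = def `PermanentalCouplingFromInputs`, by name). -/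
theorem PermanentalCouplingFromInputs :
    Summit.QuantumFields.YangMills.Cruxes.FemtoCurvatureSkewness.SketchIdeator3.PermanentalCouplingFromInputs := by
  sorry

/-- Stub R (residual), registered form (statement = def `PackagePinsScale`, by name). -/
theorem PackagePinsScale :
    Summit.QuantumFields.YangMills.Cruxes.FemtoCurvatureSkewness.SketchIdeator3.PackagePinsScale := by
  sorry

end Stub

/-! ## The composition (kernel-checked; no `sorry` below this line) -/

/-- **The crux, unbundled** (definitional: the route decl IS `∀ G simple, ∀ r a, TwoPointPackage → SkewnessPackage`). -/
theorem crux_iff : FemtoCurvatureSkewness ↔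
    ∀ (G : Type) [Group G] [TopologicalSpace G] [IsTopologicalGroup G] [CompactSpace G],
      IsCompactSimpleLieGroup G →
        letI : MeasurableSpace G := borel G
        haveI : BorelSpace G := ⟨rfl⟩
        ∀ (r : LatticeRep G) (a : ℝ → ℝ), TwoPointPackage r a → SkewnessPackage r a :=
  Iff.rfl

/-- The scalar core of the rigidity transfer: relative error `θ` on a prediction `p` leaves the lower bound
`(1-θ) p`. -/
theorem lower_of_relative_error (k p θ : ℝ) (h : |k - p| ≤ θ * p) : (1 - θ) * p ≤ k := by
  have := (abs_sub_le_iff.mp h).2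
  nlinarith

section Glue

variable {G : Type} [Group G] [TopologicalSpace G] [IsTopologicalGroup G] [CompactSpace G]
  [MeasurableSpace G] [BorelSpace G]

/-- **Dominance ⇒ rigidity** (elementary): with `Cov₀₃ = Cov₀₂` (hypercubic symmetry) and `c'·Cov₀₂ ≤ Cov₂₃`,
`√(Cov₀₂·Cov₀₃·Cov₂₃) ≥ √c' · Cov₀₂ · √Cov₀₂` whenever `Cov₀₂ ≥ 0` (and the bound is trivial otherwise), so the
relative-error estimate gives `c₃ := (1−θ)·(√8/√d)·√c'`. -/
theorem rigidity_of_dominance (hsym : HypercubicCovSymmetry) (r : LatticeRep G) (a : ℝ → ℝ)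
    (hD : DominanceBounds r a) : RigidityBound r a := by
  obtain ⟨β₁, ℓ₁, d, θ, c', hℓ₁, hd, hθ0, hθ1, hc', H⟩ := hD
  have hsd : 0 < Real.sqrt 8 / Real.sqrt d :=
    div_pos (Real.sqrt_pos.2 (by norm_num)) (Real.sqrt_pos.2 hd)
  have h1θ : 0 < 1 - θ := by linarith
  refine ⟨β₁, ℓ₁, (1 - θ) * (Real.sqrt 8 / Real.sqrt d) * Real.sqrt c', hℓ₁, by positivity, ?_⟩
  intro L _ β hβ hL n hn h8
  obtain ⟨hdom, hC⟩ := H L β hβ hL n hn h8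
  rw [hsym G r L β n] at hdom
  -- abbreviations
  set A := (n : ℝ) ^ 8 *
    wCov r L β (plaq r L 0 0 1) (plaq r L (Pi.single (2 : Fin 4) ((n : ℕ) : ZMod L)) 0 1) with hAdef
  set C := (n : ℝ) ^ 8 *
    wCov r L β (plaq r L (Pi.single (2 : Fin 4) ((n : ℕ) : ZMod L)) 0 1)
      (plaq r L (Pi.single (3 : Fin 4) ((n : ℕ) : ZMod L)) 0 1) with hCdef
  set K := (n : ℝ) ^ 12 * |kappa3 r L β n| with hKdef
  have hK0 : 0 ≤ K := by positivity
  have hlow := lower_of_relative_error K _ θ hdom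
  by_cases hA : 0 ≤ A
  · have hcA : 0 ≤ c' * A := by positivity
    have hC0 : 0 ≤ C := hcA.trans hC
    have hsq : Real.sqrt c' * A * Real.sqrt A ≤ Real.sqrt (A * A * C) := by
      have hl : 0 ≤ Real.sqrt c' * A * Real.sqrt A := by positivity
      rw [Real.le_sqrt hl (mul_nonneg (mul_nonneg hA hA) hC0)]
      have h1 : (Real.sqrt c' * A * Real.sqrt A) ^ 2 = c' * A * A * A := by
        rw [mul_pow, mul_pow, Real.sq_sqrt hc'.le, Real.sq_sqrt hA]; ring
      rw [h1]
      have h2 : A * A * (c' * A) ≤ A * A * C := mul_le_mul_of_nonneg_left hC (mul_nonneg hA hA)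
      nlinarith [h2]
    calc (1 - θ) * (Real.sqrt 8 / Real.sqrt d) * Real.sqrt c' * A * Real.sqrt A
        = (1 - θ) * ((Real.sqrt 8 / Real.sqrt d) * (Real.sqrt c' * A * Real.sqrt A)) := by ring
      _ ≤ (1 - θ) * ((Real.sqrt 8 / Real.sqrt d) * Real.sqrt (A * A * C)) :=
          mul_le_mul_of_nonneg_left (mul_le_mul_of_nonneg_left hsq hsd.le) h1θ.le
      _ ≤ K := hlow
  · rw [not_le] at hA
    have : Real.sqrt A = 0 := Real.sqrt_eq_zero'.2 hA.le
    rw [this, mul_zero]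
    exact hK0

/-- **Coupling ⇒ dominance** (elementary; the real-number lemma `DominanceFromCoupling` at each admissible
`(L, β, n)`, `θ := 1/2`, and `c'' := (7/9)·c'` for the diagonal clause: `A₂₃ ≥ (7/8) b₂₃ ≥ (7/8) c' b₀₂ ≥ (7/9) c' A₀₂`). -/
theorem dominance_of_coupling (h4 : DominanceFromCoupling) (r : LatticeRep G) (a : ℝ → ℝ)
    (hC : CouplingBounds r a) : DominanceBounds r a := by
  obtain ⟨β₁, ℓ₁, d, c', hℓ₁, hd, hc', H⟩ := hC
  refine ⟨β₁, ℓ₁, d, 1 / 2, 7 / 9 * c', hℓ₁, hd, by norm_num, by norm_num, by positivity, ?_⟩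
  intro L _ β hβ hL n hn h8
  obtain ⟨kQ, b₀₂, b₀₃, b₂₃, hb₀₂, hb₀₃, hb₂₃, hperm, hk, h₀₂, h₀₃, h₂₃, hdiag⟩ := H L β hβ hL n hn h8
  refine ⟨?_, ?_⟩
  · have habs : |(n : ℝ) ^ 12 * |kappa3 r L β n| - Real.sqrt 8 / Real.sqrt d * Real.sqrt
          (((n : ℝ) ^ 8 *
              wCov r L β (plaq r L 0 0 1) (plaq r L (Pi.single (2 : Fin 4) ((n : ℕ) : ZMod L)) 0 1)) *
            ((n : ℝ) ^ 8 *
              wCov r L β (plaq r L 0 0 1) (plaq r L (Pi.single (3 : Fin 4) ((n : ℕ) : ZMod L)) 0 1)) *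
            ((n : ℝ) ^ 8 *
              wCov r L β (plaq r L (Pi.single (2 : Fin 4) ((n : ℕ) : ZMod L)) 0 1)
                (plaq r L (Pi.single (3 : Fin 4) ((n : ℕ) : ZMod L)) 0 1)))| =
        |(|(n : ℝ) ^ 12 * kappa3 r L β n|) - Real.sqrt 8 / Real.sqrt d * Real.sqrt
          (((n : ℝ) ^ 8 *
              wCov r L β (plaq r L 0 0 1) (plaq r L (Pi.single (2 : Fin 4) ((n : ℕ) : ZMod L)) 0 1)) *
            ((n : ℝ) ^ 8 *
              wCov r L β (plaq r L 0 0 1) (plaq r L (Pi.single (3 : Fin 4) ((n : ℕ) : ZMod L)) 0 1)) *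
            ((n : ℝ) ^ 8 *
              wCov r L β (plaq r L (Pi.single (2 : Fin 4) ((n : ℕ) : ZMod L)) 0 1)
                (plaq r L (Pi.single (3 : Fin 4) ((n : ℕ) : ZMod L)) 0 1)))| := by
      rw [abs_mul, abs_of_nonneg (by positivity : (0 : ℝ) ≤ (n : ℝ) ^ 12)]
    rw [habs]
    exact h4 d _ kQ _ _ _ b₀₂ b₀₃ b₂₃ hd hb₀₂ hb₀₃ hb₂₃ hperm hk h₀₂ h₀₃ h₂₃
  · have h1 := (abs_sub_le_iff.1 h₀₂).1
    have h2 := (abs_sub_le_iff.1 h₂₃).2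
    nlinarith [h1, h2, hdiag, hc'.le, hb₀₂.le]

/-- **Rigidity on the boxes of a comparable map ⇒ the skewness package** (elementary; the algebra of ideator-3's
`crux_of_core`): for `β ≥ β₂` the regime `L·a' ≤ ε ℓ₁` lies inside `L·a₀ ≤ ℓ₁`, and
`c₃ (n⁸Cov₀₂)^{3/2} ≥ c₃ (c'Γ'(n a' β))^{3/2}` uses the package of `a'` itself; `Γ₃ := (c'Γ')^{3/2}`. -/
theorem skewnessPackage_of_rigidity (r : LatticeRep G) {a₀ a' : ℝ → ℝ} (hR : RigidityBound r a₀)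
    {ε β₂ : ℝ} (hε : 0 < ε) (hcmp : ∀ β : ℝ, β₂ ≤ β → ε * a₀ β ≤ a' β) (ha' : TwoPointPackage r a') :
    SkewnessPackage r a' := by
  obtain ⟨β₁, ℓ₁, c₃, hℓ₁, hc₃, hLB⟩ := hR
  obtain ⟨Γ', β₀', ℓ₀', c', C', hℓ₀', hc', ha'pos, -, hΓ', hpack'⟩ := ha'
  refine ⟨fun s => (c' * Γ' s) * Real.sqrt (c' * Γ' s), max (max β₁ β₂) β₀', min (ε * ℓ₁) ℓ₀', c₃,
    lt_min (mul_pos hε hℓ₁) hℓ₀', hc₃, ?_, ?_⟩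
  · intro s hs hsl
    have hG' := (hΓ' s hs (hsl.trans (min_le_right _ _))).1
    have : 0 < c' * Γ' s := mul_pos hc' hG'
    positivity
  · intro L _ β hβ hL n hn h8
    have hβ₁ : β₁ ≤ β := le_trans (le_trans (le_max_left _ _) (le_max_left _ _)) hβ
    have hβ₂ : β₂ ≤ β := le_trans (le_trans (le_max_right _ _) (le_max_left _ _)) hβ
    have hβ₀' : β₀' ≤ β := le_trans (le_max_right _ _) hβ
    have hLa' : (L : ℝ) * a' β ≤ ℓ₀' := hL.trans (min_le_right _ _)
    have hLa : (L : ℝ) * a₀ β ≤ ℓ₁ := by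
      have h1 : ε * a₀ β ≤ a' β := hcmp β hβ₂
      have h2 : (L : ℝ) * a' β ≤ ε * ℓ₁ := hL.trans (min_le_left _ _)
      have hL0 : (0 : ℝ) ≤ L := Nat.cast_nonneg L
      have h3 : ε * ((L : ℝ) * a₀ β) ≤ ε * ℓ₁ := by nlinarith [mul_le_mul_of_nonneg_left h1 hL0]
      exact le_of_mul_le_mul_left h3 hε
    have hc1 := hLB L β hβ₁ hLa n hn h8
    have hp1 := ((hpack' L β hβ₀' hLa').1 n hn h8).1
    set A := (n : ℝ) ^ 8 *
      wCov r L β (plaq r L 0 0 1) (plaq r L (Pi.single (2 : Fin 4) ((n : ℕ) : ZMod L)) 0 1) with hAdef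
    have hlow : c' * Γ' ((n : ℝ) * a' β) ≤ A := hp1
    have hpos : 0 ≤ c' * Γ' ((n : ℝ) * a' β) := by
      have hs : 0 < (n : ℝ) * a' β := mul_pos (by exact_mod_cast hn) (ha'pos β)
      have hsl : (n : ℝ) * a' β ≤ ℓ₀' := by
        have : (n : ℝ) * a' β ≤ (L : ℝ) * a' β := by
          have : (n : ℝ) ≤ (L : ℝ) := by
            exact_mod_cast (le_trans (Nat.le_mul_of_pos_left n (by norm_num)) h8)
          exact mul_le_mul_of_nonneg_right this (ha'pos β).le
        exact this.trans hLa'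
      exact (mul_pos hc' (hΓ' _ hs hsl).1).le
    have hmono : c' * Γ' ((n : ℝ) * a' β) * Real.sqrt (c' * Γ' ((n : ℝ) * a' β)) ≤ A * Real.sqrt A :=
      mul_le_mul hlow (Real.sqrt_le_sqrt hlow) (Real.sqrt_nonneg _) (hpos.trans hlow)
    calc c₃ * (c' * Γ' ((n : ℝ) * a' β) * Real.sqrt (c' * Γ' ((n : ℝ) * a' β)))
        ≤ c₃ * (A * Real.sqrt A) := mul_le_mul_of_nonneg_left hmono hc₃.le
      _ = c₃ * A * Real.sqrt A := by ring
      _ ≤ (n : ℝ) ^ 12 * |kappa3 r L β n| := hc1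

end Glue

/-- **`FemtoCurvatureSkewness_of`** — the glue of the line over exactly the two open stubs (the five landed inputs are
used by name): the engine (fed its three provable inputs) yields a package map `a₀` with coupling bounds, hence
dominance (`DominanceFromCoupling`); hypercubic symmetry + the relative-error algebra
give rigidity on `a₀`-boxes; `PackagePinsScale` compares the crux's arbitrary package map `a'` with `a₀`; the
package of `a'` closes with `Γ₃ := (c'Γ')^{3/2}`. -/
theorem FemtoCurvatureSkewness_of (hE : PermanentalCouplingFromInputs) (hP : PackagePinsScale) :
    FemtoCurvatureSkewness := by
  rw [crux_iff]
  intro G _ _ _ _ hG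
  letI : MeasurableSpace G := borel G
  haveI : BorelSpace G := ⟨rfl⟩
  intro r a' ha'
  obtain ⟨a₀, hPkg₀, hCpl₀⟩ :=
    hE permanentalRigidity_holds perpPropagatorPos_holds totalCumulance_holds G hG r ⟨a', ha'⟩
  obtain ⟨ε, β₂, hε, hcmp⟩ := hP G hG r a₀ a' hPkg₀ ha'
  exact skewnessPackage_of_rigidity r
    (rigidity_of_dominance hypercubicCovSymmetry_holds r a₀
      (dominance_of_coupling dominanceFromCoupling_holds r a₀ hCpl₀)) hε hcmp ha'

/-- **The skeleton**: the crux modulo exactly the two OPEN registered stubs `Stub.*` (five landed). -/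
theorem FemtoCurvatureSkewness_proof : FemtoCurvatureSkewness :=
  FemtoCurvatureSkewness_of Stub.PermanentalCouplingFromInputs Stub.PackagePinsScale

/-! ## Under the planners' repair R1 (∃-bundled form) the line closes modulo the ENGINE alone -/

/-- **The ∃-bundled (assembly-sufficient) form of the crux** (Memo-forall-a-exposure, repair R1; ideator-3's
`SkewnessForPackageMap`): for every compact simple `G` and `r`, IF some unit map carries the two-point package THEN some
unit map carries the package together with the skewness witness — which is all `closes` consumes (`hSkew G hG r a ha` at
the `a` of `hUV`, once `hUV`'s map is taken from here). -/
def SkewnessForPackageMap : Prop :=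
  ∀ (G : Type) [Group G] [TopologicalSpace G] [IsTopologicalGroup G] [CompactSpace G],
    IsCompactSimpleLieGroup G →
      letI : MeasurableSpace G := borel G
      haveI : BorelSpace G := ⟨rfl⟩
      ∀ (r : LatticeRep G), (∃ a : ℝ → ℝ, TwoPointPackage r a) →
        ∃ a : ℝ → ℝ, TwoPointPackage r a ∧ SkewnessPackage r a

/-- **R1 check (kernel):** the engine stub ALONE gives the ∃-bundled form — the residual `PackagePinsScale` is needed
only for the typed `∀ a` shell.  (`ε := 1`, `a' := a₀`.) -/
theorem skewnessForPackageMap_of (hE : PermanentalCouplingFromInputs) : SkewnessForPackageMap := by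
  intro G _ _ _ _ hG
  letI : MeasurableSpace G := borel G
  haveI : BorelSpace G := ⟨rfl⟩
  intro r hex
  obtain ⟨a₀, hPkg₀, hCpl₀⟩ :=
    hE permanentalRigidity_holds perpPropagatorPos_holds totalCumulance_holds G hG r hex
  refine ⟨a₀, hPkg₀, skewnessPackage_of_rigidity r
    (rigidity_of_dominance hypercubicCovSymmetry_holds r a₀
      (dominance_of_coupling dominanceFromCoupling_holds r a₀ hCpl₀)) one_pos (β₂ := 0)
        (fun β _ => le_of_eq (one_mul _)) hPkg₀⟩

/-- The ∃-bundled form modulo the one open engine stub. -/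
theorem skewnessForPackageMap_proof : SkewnessForPackageMap :=
  skewnessForPackageMap_of Stub.PermanentalCouplingFromInputs

end Summit.QuantumFields.YangMills.Cruxes.FemtoCurvatureSkewness.SketchIdeator3

end
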